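import Summits.CriticalPhenomena.Ising3DConformalLimit.Theorems.HyperoctahedralRPLimitRotationInvariantBoostEntireOfType
import HarnessLib

/-!
# Stub `stub_boostEntireOfTypeAxis` (S4') of the line `quarter-turn-liouville`,
crux `HyperoctahedralRP.LimitRotationInvariant` (stmt-CriticalPhenomena-1980)

Lead's reshape (2026-08-16, cycle 1): the landed inductive step `stub_boostEntireOfType`
(`Theorems/HyperoctahedralRPLimitRotationInvariantBoostEntireOfType.lean`, p96589) consumes the nine-frame
`TwoSidedSigmaBound Δ S` only through its frame-`e₀` instance (`frameSigma_of`).  This file re-states the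
inductive step with exactly that instance — the AXIS SIGMA BOUND, written out over tree vocabulary
(`axisReflection 0`, `EuclideanSpace.single 0 1`) — as hypothesis, so that the line's one open stub (S3',
`stub_axisSigmaBound`) is precisely what the composition uses and nothing more.  The proof is the landed one
verbatim (same helpers, imported), with the sigma bound taken from the hypothesis instead of `frameSigma_of`.
-/

noncomputable section

open scoped BigOperators InnerProductSpace
open ComplexConjugate
open Literature.Probability.LatticeModels
open Literature.MathematicalPhysics.QuantumFieldTheory
open Literature.Analysis.OperatorTheory Literature.Analysis.OperatorTheory.KernelVectors
  Literature.Analysis.Complex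

namespace Summit.CriticalPhenomena.Ising3DConformalLimit.Cruxes.LimitRotationInvariant.QuarterTurnLiouville

/-- **S4' · `stub_boostEntireOfTypeAxis`.** INDUCTIVE STEP at level `n ≥ 3` from the frame-`e₀` sigma bound
only: assuming `O(3)` invariance at all levels `< n`, the in-plane light cone and the AXIS sigma bound
(`‖e^{-uH} σ̂(y) e^{-vH}‖ ≤ C (u^{-Δ} + v^{-Δ})` in the OS space of the mirror `x₀ = 0`, correlation-function
form), for every axis-generic `x` the orbit function `θ ↦ S n (rot θ ∘ x)` is the restriction of an entire
function of exponential type `2Δ < 4` (Osterwalder–Schrader boost calculus of the frame `e₀`,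
`exists_local_boost_continuation`, glued over one period `π/2`). -/
theorem stub_boostEntireOfTypeAxis :
    ∀ (Δ : ℝ) (S : CorrFamily 3), LimitStructure Δ S → InPlaneLightCone S →
      (∃ C : ℝ, ∀ u v : ℝ, 0 < u → 0 < v → ∀ y : EuclideanSpace ℝ (Fin 3), y 0 = 0 →
        ∀ (m : ℕ) (k : Fin m → ℕ) (A : (a : Fin m) → Fin (k a) → EuclideanSpace ℝ (Fin 3)) (c : Fin m → ℝ)
          (m' : ℕ) (k' : Fin m' → ℕ) (B : (b : Fin m') → Fin (k' b) → EuclideanSpace ℝ (Fin 3))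
          (d : Fin m' → ℝ),
          (∀ a i, 0 < A a i 0) → (∀ b j, 0 < B b j 0) →
          (∑ a, ∑ b, c a * d b * S (k a + 1 + k' b)
              (Fin.append (Fin.append (fun i => axisReflection 0 (A a i + u • EuclideanSpace.single 0 1)) ![y])
                (fun j => B b j + v • EuclideanSpace.single 0 1))) ^ 2
            ≤ (C * (u ^ (-Δ) + v ^ (-Δ))) ^ 2 *
              (∑ a, ∑ a', c a * c a' * S (k a + k a')
                (Fin.append (fun i => axisReflection 0 (A a i)) (A a'))) *
              (∑ b, ∑ b', d b * d b' * S (k' b + k' b')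
                (Fin.append (fun j => axisReflection 0 (B b j)) (B b')))) →
      ∀ n : ℕ, 3 ≤ n → (∀ m < n, RotInvAt S m) →
      ∀ x : Fin n → EuclideanSpace ℝ (Fin 3), AxisGeneric x →
        ∃ F : ℂ → ℂ, Differentiable ℂ F ∧
          (∀ θ : ℝ, F (θ : ℂ) = ((S n (fun i => rot θ (x i)) : ℝ) : ℂ)) ∧
          ∃ C τ : ℝ, τ < 4 ∧ ∀ z : ℂ, ‖F z‖ ≤ C * Real.exp (τ * |z.im|) := by
  intro Δ S hL hcone hsig n hn ih x hx
  classical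
  obtain ⟨hreg, hRP9⟩ := hL
  have hΔ : 0 ≤ Δ := by linarith [hreg.1.1]
  have hT : IsTranslationInvariant S := hreg.2.1
  have hO : IsHyperoctahedralInvariant S := hreg.2.2.2.2.2.1
  have hP : IsPermutationSymmetric S := hreg.2.2.2.2.2.2.1
  obtain ⟨Cpd, hPD⟩ := hreg.2.2.2.2.2.2.2.1
  have hRP : MirrorRP (EuclideanSpace.single 0 1) S := hRP9 _ single_zero_mem
  have hLC := frameLightCone_of hcone
  obtain ⟨C, hSB⟩ := hsig
  have hrot : ∀ m : ℕ, m < n → ∀ (φ : ℝ) (z : Fin m → EuclideanSpace ℝ (Fin 3)),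
      S m (fun i => planeRot (d := 2) 0 φ (z i)) = S m z := fun m hm φ z => ih m hm (rot φ) z
  -- the OS Hilbert space of the frame `e₀` (Mathlib's RKHS of the OS kernel)
  set kfun : HalfSpaceConfig 3 0 → HalfSpaceConfig 3 0 → ℂ := fun a b => ((osPointKernel S a b : ℝ) : ℂ) with hkfun
  have hk : ∀ a b, conj (kfun b a) = kfun a b := by
    intro a b
    simp only [hkfun, Complex.conj_ofReal, osPointKernel_comm (isReflectionInvariantAlong_zero hO) hP b a]
  haveI : Fact (Matrix.of fun a b => kfun a b • (1 : ℂ →L[ℂ] ℂ)).PosSemidef :=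
    ⟨posSemidef_smul_one kfun hk fun c => kernel_psd_complex hRP c⟩
  set δ : HalfSpaceConfig 3 0 → RKHS.OfKernel (Matrix.of fun a b => kfun a b • (1 : ℂ →L[ℂ] ℂ)) :=
    fun a => RKHS.kerFun (RKHS.OfKernel (Matrix.of fun a b => kfun a b • (1 : ℂ →L[ℂ] ℂ))) a (1 : ℂ) with hδdef
  have hδ : DenseRange (Finsupp.linearCombination ℂ δ) := denseRange_lc_kerFun_one _
  have hK : ∀ a b, ⟪δ a, δ b⟫_ℂ = ((osPointKernel S a b : ℝ) : ℂ) := fun a b => inner_kerFun_one kfun hk a b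
  -- local continuations around every angle
  have hloc : ∀ θ₁ : ℝ, ∃ ε : ℝ, 0 < ε ∧ ∃ K : ℝ, ∃ F : ℂ → ℂ,
      DifferentiableOn ℂ F {z : ℂ | |z.re - θ₁| < ε} ∧
      (∀ θ : ℝ, |θ - θ₁| < ε → F θ = ((S n (fun i => rot θ (x i)) : ℝ) : ℂ)) ∧
      ∀ z : ℂ, |z.re - θ₁| < ε → ‖F z‖ ≤ K * Real.exp (2 * Δ * |z.im|) := by
    -- the frame is usable at `θ₂`: continuation around `θ₂`
    have husable : ∀ θ₂ : ℝ, (∀ i j : Fin n, i ≠ j → rot θ₂ (x i) 0 ≠ rot θ₂ (x j) 0) →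
        ∃ ε : ℝ, 0 < ε ∧ ∃ K : ℝ, ∃ F : ℂ → ℂ,
          DifferentiableOn ℂ F {z : ℂ | |z.re - θ₂| < ε} ∧
          (∀ θ : ℝ, |θ - θ₂| < ε → F θ = ((S n (fun i => rot θ (x i)) : ℝ) : ℂ)) ∧
          ∀ z : ℂ, |z.re - θ₂| < ε → ‖F z‖ ≤ K * Real.exp (2 * Δ * |z.im|) := by
      intro θ₂ hd
      obtain ⟨σ, ε, h, hε, hε1, hh, hgap⟩ := exists_sorted_gaps (by omega) x θ₂ hd
      obtain ⟨F, hFd, hFv, K, hFb⟩ := exists_local_boost_continuation S hΔ δ hδ hK hT hP hLC hSB hPD hn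
        (fun i => x (σ i)) hrot hε1 hh hgap
      refine ⟨ε, hε, K, F, hFd, fun θ hθ => ?_, hFb⟩
      rw [hFv θ hθ]
      norm_cast
      exact hP n σ (fun i => rot θ (x i))
    intro θ₁
    rcases heights_injective_or hx θ₁ with h | h
    · exact husable θ₁ h
    · obtain ⟨ε, hε, K, F, hFd, hFv, hFb⟩ := husable (θ₁ + Real.pi / 2) h
      refine ⟨ε, hε, K, fun z => F (z + (Real.pi / 2 : ℝ)), ?_, fun θ hθ => ?_, fun z hz => ?_⟩
      · refine hFd.comp (differentiableOn_id.add_const _) fun z hz => ?_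
        simpa [add_sub_add_right_eq_sub] using hz
      · have e : (θ : ℂ) + ((Real.pi / 2 : ℝ) : ℂ) = ((θ + Real.pi / 2 : ℝ) : ℂ) := by push_cast; ring
        show F ((θ : ℂ) + ((Real.pi / 2 : ℝ) : ℂ)) = _
        rw [e, hFv _ (by simpa [add_sub_add_right_eq_sub] using hθ)]
        norm_cast
        exact orbit_periodic hO x θ
      · have := hFb (z + ((Real.pi / 2 : ℝ) : ℂ)) (by simpa [add_sub_add_right_eq_sub] using hz)
        simpa using this
  -- gluing over one period
  have hper : ∀ θ : ℝ, ((S n (fun i => rot (θ + Real.pi / 2) (x i)) : ℝ) : ℂ) =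
      ((S n (fun i => rot θ (x i)) : ℝ) : ℂ) := fun θ => by exact_mod_cast orbit_periodic hO x θ
  obtain ⟨G, hGd, hGκ, Cst, hGb⟩ := exists_entire_of_periodic_local_continuations
    (κ := fun θ : ℝ => ((S n (fun i => rot θ (x i)) : ℝ) : ℂ)) (T := Real.pi / 2) (τ := 2 * Δ)
    (by positivity) hper hloc
  exact ⟨G, hGd, hGκ, Cst, 2 * Δ, by linarith [hreg.1.2], hGb⟩

end Summit.CriticalPhenomena.Ising3DConformalLimit.Cruxes.LimitRotationInvariant.QuarterTurnLiouville

end
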